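import Summits.ResolutionOfSingularities.ResolutionOfSingularities.Theorems.FrobeniusClosingPatchingRelPerfectConeCubeDepthLevelTwo
import Summits.ResolutionOfSingularities.ResolutionOfSingularities.Theorems.FrobeniusClosingPatchingRelPerfectConeCube
import HarnessLib

/-!
# Crux `PatchingRelPerfect` (stmt-ResolutionOfSingularities-16161), chain w52 — the contact-migration
# member at EVERY depth: `(x₀x₁ + x₂² + x₃³) + 𝔪^{ℓ+2} ∈ 𝒞` for all `ℓ ≥ 1`, kernel-checked

[OURS · L1 W5.2 · rung] Generalises `…ConeCube` (`ℓ = 2`).  `S` regular local of dimension four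
with regular system of parameters `x₀, …, x₃` (any characteristic, any residue field),
`f = x₀x₁ + x₂² + x₃³`, `I_ℓ = (f) + 𝔪^{ℓ+2}`.  Companion `Q₀ = ∏_{s<3ℓ-2} A_s · (P + 𝔪²)`,
`A_s = (f) + 𝔪^{k+2-m} (P + 𝔪²)^m`, `(k, m) = ((s+2)/3, (s+2)%3)`, `P = (x₀, x₁, x₂)`
(`A_{3ℓ-2} = I_ℓ`).  Level one: `A_s B_i = u² ((F♯) + uᵏ N₀ᵐ)` (`map_chartBase_cmA`); on the
side charts the two-letter tower of `…ConeCubeSide` with the word `1 u 1 1 u 1 1 u …`; on the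
vertex chart the path `Π_{3ℓ-1}` of `…ConeCubeDepthLevelTwo` (letter tower of length `3ℓ-1`,
word `w G w w G …`).  PROVED: `coreRung_coneCube_depth` (every `ℓ ≥ 1`), `…_of_ringKrullDim`,
`atomDimFourBlowupAt_coneCube_depth` (the registered core's binder shape).  So the
contact-migration mechanism (maximal contact migrating from `E` to the strict transform of
`V(f)`) is certified FACT-FREE AT EVERY DEPTH — the `ℓ`-indexed instance family of plan-1's R5ᴴ.
Nothing here is a statement of the manuscript under review.

## References

* The Stacks Project, Tags 080A, 080B, 0804, 0BIQ. [StacksProject]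
* Q. Liu, *Algebraic Geometry and Arithmetic Curves*, OUP 2002, Thm. 8.1.19 (a). [Liu2002]
-/

-- `Summit.<Summit>.<Sub>.Theorems` with `Sub = Summit` (single-conjunct summit, D-0017)
set_option linter.dupNamespace false

noncomputable section

open CategoryTheory CategoryTheory.Limits AlgebraicGeometry Literature.AlgebraicGeometry.Resolution
open IsLocalRing

namespace Summit.ResolutionOfSingularities.ResolutionOfSingularities.Theorems

namespace ConeRung

universe u

/-! ## Level one: the companion factors `A_s` on the Rees charts of `Bl_𝔪` (any ring) -/

section LevelOne

variable {S : Type u} [CommRing S] (x : Fin 4 → S) (i : Fin 4)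

local notation3 "M" => Ideal.span (Set.range x)
local notation3 "PP" => Ideal.span {x 0, x 1, x 2}
local notation3 "fC" => x 0 * x 1 + x 2 ^ 2 + x 3 ^ 3
/-- the companion factor of node `s` -/
local notation3 "cmA[" s "]" => Ideal.span {x 0 * x 1 + x 2 ^ 2 + x 3 ^ 3} ⊔
  Ideal.span (Set.range x) ^ ((s + 2) / 3 + 2 - (s + 2) % 3) *
    (Ideal.span {x 0, x 1, x 2} ⊔ Ideal.span (Set.range x) ^ 2) ^ ((s + 2) % 3)
local notation3 "φ" => chartBase x i
local notation3 "u" => chartBase x i (x i)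
local notation3 "Fs" => chartGen x i 0 * chartGen x i 1 + chartGen x i 2 ^ 2 +
  chartBase x i (x i) * chartGen x i 3 ^ 3
local notation3 "U" => Ideal.span {chartBase x i (x i)}
local notation3 "N0" => Ideal.span {chartBase x i (x i), chartGen x i 0, chartGen x i 1, chartGen x i 2}

/-- **`A_{k,m} B_i = u² · ((F♯) + uᵏ N₀ᵐ)`** for `A_{k,m} = (f) + 𝔪^{k+2-m}(P + 𝔪²)^m`, `m ≤ k + 2`.
[folklore] -/
theorem map_chartBase_cmA_aux (k m : ℕ) (hm : m ≤ k + 2) :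
    (Ideal.span {fC} ⊔ M ^ (k + 2 - m) * (PP ⊔ M ^ 2) ^ m).map φ =
      U ^ 2 * (Ideal.span {Fs} ⊔ U ^ k * N0 ^ m) := by
  rw [Ideal.map_sup, Ideal.map_mul, Ideal.map_pow, Ideal.map_pow, map_chartBase_M, map_chartBase_PM,
    map_chartBase_span_fC, mul_pow, ← mul_assoc, ← pow_add, Nat.sub_add_cancel hm, Ideal.mul_sup,
    pow_add]
  congr 1
  ring

/-- The companion factor of node `s` on the chart: `u² · ((F♯) + uᵏ N₀ᵐ)`, `(k, m) = ((s+2)/3, (s+2)%3)`.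
[folklore] -/
theorem map_chartBase_cmA (s : ℕ) :
    (cmA[s]).map φ = U ^ 2 * (Ideal.span {Fs} ⊔ U ^ ((s + 2) / 3) * N0 ^ ((s + 2) % 3)) :=
  map_chartBase_cmA_aux x i _ _ (by omega)

/-- **The product of the companion factors on the chart**:
`(∏_{s<n} A_s) B_i = (u)^{2n} · ∏_{s<n} ((F♯) + u^{k_s} N₀^{m_s})`. [folklore] -/
theorem map_chartBase_cmProd (n : ℕ) :
    (∏ s ∈ Finset.range n, cmA[s]).map φ =
      U ^ (2 * n) * ∏ s ∈ Finset.range n,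
        (Ideal.span {Fs} ⊔ U ^ ((s + 2) / 3) * N0 ^ ((s + 2) % 3)) := by
  rw [map_finset_prod]
  simp_rw [map_chartBase_cmA x i]
  rw [Finset.prod_mul_distrib, Finset.prod_const, Finset.card_range, ← pow_mul]

/-- **The total transform of `(∏_{s<n} A_s) · (P + 𝔪²)`**: `(u)^{2n+1} · [∏_{s<n} (…)] · N₀`.
[folklore] -/
theorem map_chartBase_cmIQ (n : ℕ) :
    ((∏ s ∈ Finset.range n, cmA[s]) * (PP ⊔ M ^ 2)).map φ =
      U ^ (2 * n + 1) * ((∏ s ∈ Finset.range n,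
        (Ideal.span {Fs} ⊔ U ^ ((s + 2) / 3) * N0 ^ ((s + 2) % 3))) * N0) := by
  rw [Ideal.map_mul, map_chartBase_cmProd, map_chartBase_PM, pow_succ]
  ring

/-- The last node is the member: `A_{3ℓ-2} = (f) + 𝔪^{ℓ+2}`. [folklore] -/
theorem cmA_last (ℓ : ℕ) (hℓ : 1 ≤ ℓ) : cmA[3 * ℓ - 2] = Ideal.span {fC} ⊔ M ^ (ℓ + 2) := by
  rw [show (3 * ℓ - 2 + 2) / 3 = ℓ by omega, show (3 * ℓ - 2 + 2) % 3 = 0 by omega, pow_zero,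
    mul_one, Nat.sub_zero]

/-- **`I_ℓ · Q₀ = (∏_{s<3ℓ-1} A_s) · (P + 𝔪²)`** for `Q₀ = (∏_{s<3ℓ-2} A_s) · (P + 𝔪²)`. [folklore] -/
theorem cmI_mul_Q0 (ℓ : ℕ) (hℓ : 1 ≤ ℓ) :
    (Ideal.span {fC} ⊔ M ^ (ℓ + 2)) * ((∏ s ∈ Finset.range (3 * ℓ - 2), cmA[s]) * (PP ⊔ M ^ 2)) =
      (∏ s ∈ Finset.range (3 * ℓ - 1), cmA[s]) * (PP ⊔ M ^ 2) := by
  rw [show 3 * ℓ - 1 = 3 * ℓ - 2 + 1 by omega, Finset.prod_range_succ, cmA_last x ℓ hℓ]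
  ring

/-- **The companion bound**: `𝔪ᴺ ≤ ∏_{s<n} A_s` for some `N`. [folklore] -/
theorem exists_pow_le_cmProd (n : ℕ) : ∃ N : ℕ, M ^ N ≤ ∏ s ∈ Finset.range n, cmA[s] := by
  induction n with
  | zero => exact ⟨0, by rw [pow_zero, Finset.prod_range_zero]⟩
  | succ n ih =>
    obtain ⟨N, hN⟩ := ih
    refine ⟨N + ((n + 2) / 3 + 2 - (n + 2) % 3 + 2 * ((n + 2) % 3)), ?_⟩
    rw [Finset.prod_range_succ, pow_add]
    refine Ideal.mul_mono hN (le_sup_of_le_right ?_)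
    rw [pow_add, pow_mul]
    exact Ideal.mul_mono_right (Ideal.pow_right_mono le_sup_right _)

/-- `𝔪ᴺ ≤ Q₀` for some `N`. [folklore] -/
theorem exists_pow_le_cmQ0 (n : ℕ) :
    ∃ N : ℕ, M ^ N ≤ (∏ s ∈ Finset.range n, cmA[s]) * (PP ⊔ M ^ 2) := by
  obtain ⟨N, hN⟩ := exists_pow_le_cmProd x n
  exact ⟨N + 2, by rw [pow_add]; exact Ideal.mul_mono hN le_sup_right⟩

/-! ### The side charts: the two-letter word `1 u 1 1 u 1 1 u …` -/

/-- `u^{(s+2)/3} = L'₀ ⋯ L'_s` for `L'_r = u` (`r % 3 = 1`), `L'_r = 1` otherwise. [folklore] -/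
theorem cmSideFlag_prod_letters {B : Type*} [CommRing B] (a : B) (s : ℕ) :
    a ^ ((s + 2) / 3) = ∏ r ∈ Finset.range (s + 1), (if r % 3 = 1 then a else 1) := by
  induction s with
  | zero => simp
  | succ s ih =>
    rw [Finset.prod_range_succ, ← ih]
    by_cases h : (s + 1) % 3 = 1
    · rw [if_pos h, show (s + 1 + 2) / 3 = (s + 2) / 3 + 1 by omega, pow_succ]
    · rw [if_neg h, show (s + 1 + 2) / 3 = (s + 2) / 3 by omega, mul_one]

/-- The side letters lie in `{u, 1}`. [folklore] -/
theorem cmSideLetters_spec {B : Type*} [CommRing B] (a : B) (r : ℕ) :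
    (if r % 3 = 1 then a else 1) = a ∨ (if r % 3 = 1 then a else 1) = 1 := by
  by_cases h : r % 3 = 1
  · exact Or.inl (if_pos h)
  · exact Or.inr (if_neg h)

/-- **On the charts `i ≤ 2`** (`N₀ = (1)`): `∏_{s<n} ((F♯) + u^{k_s} N₀^{m_s}) = ∏_{s<n} (F♯, L'₀⋯L'_s)`,
the two-letter flag of `…LetterTowerTwo`. [folklore] -/
theorem cmProd_of_ne_three (hi : i ≠ 3) (n : ℕ) :
    ∏ s ∈ Finset.range n, (Ideal.span {Fs} ⊔ U ^ ((s + 2) / 3) * N0 ^ ((s + 2) % 3)) =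
      ∏ s ∈ Finset.range n, Ideal.span {Fs, ∏ r ∈ Finset.range (s + 1), (if r % 3 = 1 then u else 1)} := by
  refine Finset.prod_congr rfl fun s _ => ?_
  rw [span_u_e_eq_top_of_ne_three x i hi, Ideal.top_pow, Ideal.mul_top, Ideal.span_singleton_pow,
    cmSideFlag_prod_letters, Ideal.span_insert]

end LevelOne

/-! ## Level one over a regular local base -/

section LevelOneRegular

variable {S : Type u} [CommRing S] [IsRegularLocalRing S] (x : Fin 4 → S)
  (hx : Ideal.span (Set.range x) = IsLocalRing.maximalIdeal S)
  (hd : (IsLocalRing.maximalIdeal S).spanFinrank = 4)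

local notation3 "M" => Ideal.span (Set.range x)
local notation3 "PP" => Ideal.span {x 0, x 1, x 2}
local notation3 "fC" => x 0 * x 1 + x 2 ^ 2 + x 3 ^ 3
local notation3 "cmA[" s "]" => Ideal.span {x 0 * x 1 + x 2 ^ 2 + x 3 ^ 3} ⊔
  Ideal.span (Set.range x) ^ ((s + 2) / 3 + 2 - (s + 2) % 3) *
    (Ideal.span {x 0, x 1, x 2} ⊔ Ideal.span (Set.range x) ^ 2) ^ ((s + 2) % 3)
/-- the vertex-chart family index `k ↦ castSucc k ≠ 3` -/
local notation3 "jJ3" =>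
  (fun k : Fin 3 => (⟨Fin.castSucc k, castSucc_ne_three k⟩ : {j : Fin 4 // j ≠ 3}))

include hx hd in
/-- **Side charts `i ≤ 2`**: every blowing up of `Spec B_i` along `((∏_{s<n} A_s)·(P+𝔪²)) B_i` is
regular — twist off `u^{2n+1}` and run the two-letter tower `isRegular_of_isBlowup_letterTower_two''`
(`…ConeCubeSide` hypotheses). [cite: StacksProject, Tag 080B] [cite: Liu2002, Thm. 8.1.19 (a)] -/
theorem isRegular_of_isBlowup_cmIQ_of_ne_three (n : ℕ) (i : Fin 4) (hi : i ≠ 3) {Y : Scheme.{u}}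
    {ρ : Y ⟶ Spec (.of (chartRing x i))}
    (hρ : IsBlowup ρ (affineBlowup.idealSheaf
      (((∏ s ∈ Finset.range n, cmA[s]) * (PP ⊔ M ^ 2)).map (chartBase x i)))) :
    Scheme.IsRegular Y := by
  haveI : IsDomain S := isDomain_of_isRegularLocalRing S
  haveI := isRegularRing_chart x hx hd i
  have hxi : x i ≠ 0 := (isRsopPart_comp_of_rsop hd x hx id Function.injective_id).ne_zero i
  haveI : IsDomain (chartRing x i) := isDomain_chartRing x i hxi
  have hu : chartBase x i (x i) ∈ nonZeroDivisors (chartRing x i) :=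
    reesChartBase_mem_nonZeroDivisors (x i) (Ideal.mem_span_range_self (f := x) (x := i))
  have hu0 : chartBase x i (x i) ≠ 0 := nonZeroDivisors.ne_zero hu
  rw [map_chartBase_cmIQ x i n, cmProd_of_ne_three x i hi, span_u_e_eq_top_of_ne_three x i hi,
    Ideal.mul_top, Ideal.span_singleton_pow] at hρ
  exact CoreRungTower.isRegular_of_isBlowup_span_singleton_mul (pow_mem hu _) _
    (fun Y' ρ' h' => isRegular_of_isBlowup_letterTower_two'' n _ (chartBase x i (x i))
      (fun r => if r % 3 = 1 then chartBase x i (x i) else 1)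
      (cmSideLetters_spec (chartBase x i (x i)))
      (isQuasiRegular_Fs_u x hx hd i) (isRegularRing_quot_span_Fs_u x hx hd i hi) hu0 h') hρ

include hx hd in
/-- **The vertex chart**: every blowing up of `Spec B₃` along `((∏_{s<n} A_s)·(P+𝔪²)) B₃ =
(u)^{2n+1} · Π_n · 𝔫₀` is regular — the abstract level two `isRegular_of_isBlowup_cmPi_mul_span`
with `A = B₃`. [cite: StacksProject, Tag 080A] [cite: Liu2002, Thm. 8.1.19 (a)] -/
theorem isRegular_of_isBlowup_cmIQ_three (n : ℕ) {Y : Scheme.{u}}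
    {ρ : Y ⟶ Spec (.of (chartRing x 3))}
    (hρ : IsBlowup ρ (affineBlowup.idealSheaf
      (((∏ s ∈ Finset.range n, cmA[s]) * (PP ⊔ M ^ 2)).map (chartBase x 3)))) :
    Scheme.IsRegular Y := by
  haveI : IsDomain S := isDomain_of_isRegularLocalRing S
  have hqr := isQuasiRegular_regularSystemOfParameters hd x hx
  haveI : IsRegularRing (chartRing x 3) := isRegularRing_chart x hx hd 3
  haveI := isRegularRing_residue x hx
  haveI := isDomain_residue x hx
  have hx3 : x 3 ≠ 0 := (isRsopPart_comp_of_rsop hd x hx id Function.injective_id).ne_zero 3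
  haveI : IsDomain (chartRing x 3) := isDomain_chartRing x 3 hx3
  haveI : IsRegularRing (chartRing x 3 ⧸ Ideal.span (Set.range
      (Fin.cons (chartBase x 3 (x 3)) (fun k : Fin 3 => chartGen x 3 (jJ3 k).1) :
        Fin 4 → chartRing x 3))) :=
    isRegularRing_quot_cons_chartGen x 3 jJ3 hqr
  haveI : IsDomain (chartRing x 3 ⧸ Ideal.span (Set.range
      (Fin.cons (chartBase x 3 (x 3)) (fun k : Fin 3 => chartGen x 3 (jJ3 k).1) :
        Fin 4 → chartRing x 3))) :=
    isDomain_quot_span_range_cc x hx hd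
  haveI : IsDomain (chartRing x 3 ⧸ Ideal.span {chartBase x 3 (x 3)}) :=
    isDomain_chartRing_quot_span x 3 hqr
  have hc : IsQuasiRegular (Fin.cons (chartBase x 3 (x 3))
      (fun k : Fin 3 => chartGen x 3 (jJ3 k).1) : Fin 4 → chartRing x 3) :=
    isQuasiRegular_cons_chartGen x 3 jJ3 hqr jJ3_injective
  have hv : ∀ k : Fin 3, chartGen x 3 (jJ3 k).1 ∉ Ideal.span {chartBase x 3 (x 3)} :=
    fun k => chartGen_notMem_span_u x hx hd 3 _ (castSucc_ne_three k)
  have hFt := F_notMem_span_u x hx hd 3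
  have hdF := isDomain_quot_span_u_F_three x hx hd
  have hvF : ∀ k : Fin 3, chartGen x 3 (jJ3 k).1 ∉ Ideal.span {chartBase x 3 (x 3),
      chartGen x 3 0 * chartGen x 3 1 + chartGen x 3 2 ^ 2} :=
    fun k => chartGen_notMem_span_u_F_three x hx hd k
  have hreg1 : ∀ (k : Fin 3) (P : Ideal (chartRing x 3 ⧸ Ideal.span {chartBase x 3 (x 3),
      chartGen x 3 0 * chartGen x 3 1 + chartGen x 3 2 ^ 2})) [P.IsPrime],
      Ideal.Quotient.mk _ (chartGen x 3 (Fin.castSucc k)) ∉ P →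
        IsRegularLocalRing (Localization.AtPrime P) :=
    fun k P _ hP => isRegularLocalRing_quot_span_u_F_three x hx hd P k hP
  have e1 : chartGen x 3 0 * chartGen x 3 1 + chartGen x 3 2 ^ 2 +
      chartBase x 3 (x 3) * chartGen x 3 3 ^ 3 =
      chartGen x 3 0 * chartGen x 3 1 + chartGen x 3 2 ^ 2 + chartBase x 3 (x 3) := by
    rw [show chartGen x 3 3 = 1 from chartGen_self x 3]
    ring
  rw [map_chartBase_cmIQ x 3 n, e1, Ideal.span_singleton_pow] at hρ
  exact isRegular_of_isBlowup_span_singleton_mul_of_forall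
    (pow_mem (reesChartBase_mem_nonZeroDivisors (x 3)
      (Ideal.mem_span_range_self (f := x) (x := 3))) _) _
    (fun Y' ρ' h' => isRegular_of_isBlowup_cmPi_mul_span (chartBase x 3 (x 3))
      (fun k : Fin 3 => chartGen x 3 (jJ3 k).1) hc n hdF hv hFt hvF hreg1 h') hρ

include hx hd in
/-- **CORE RUNG — the contact-migration member at EVERY depth.**  For `S` regular local with
regular system of parameters `x₀, …, x₃`, every `ℓ ≥ 1` and `I_ℓ = (x₀x₁ + x₂² + x₃³) + 𝔪^{ℓ+2}`,
every blowing up `T = Bl_{I_ℓ} Spec S` carries a non-zero ideal sheaf cosupported in the closed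
fibre whose blowing up is regular.  Every characteristic, every residue field.
[cite: StacksProject, Tag 080A] [cite: Liu2002, Thm. 8.1.19 (a)] -/
theorem coreRung_coneCube_depth (ℓ : ℕ) (hℓ : 1 ≤ ℓ) (T : Scheme.{u}) (f : T ⟶ Spec (.of S))
    (hf : IsBlowup f (affineBlowup.idealSheaf
      (Ideal.span {x 0 * x 1 + x 2 ^ 2 + x 3 ^ 3} ⊔ IsLocalRing.maximalIdeal S ^ (ℓ + 2)))) :
    ∃ (J : T.IdealSheafData) (T' : Scheme.{u}) (π : T' ⟶ T), J ≠ ⊥ ∧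
      (∀ t : T, t ∈ J.support → f.base t = IsLocalRing.closedPoint S) ∧
      IsBlowup π J ∧ Scheme.IsRegular T' := by
  haveI : IsDomain S := isDomain_of_isRegularLocalRing S
  have hx0 : x 0 ≠ 0 := (isRsopPart_comp_of_rsop hd x hx id Function.injective_id).ne_zero 0
  have h𝔪 : IsLocalRing.maximalIdeal S ≠ ⊥ := fun h => hx0 (by
    have := hx.le (Ideal.subset_span (Set.mem_range_self 0)); rw [h] at this
    exact (Submodule.mem_bot S).mp this)
  have hI : Ideal.span {fC} ⊔ M ^ (ℓ + 2) ≠ ⊥ := fun h => pow_ne_zero (ℓ + 2) h𝔪 (by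
    rw [← hx]; exact eq_bot_iff.mpr (le_sup_right.trans h.le))
  obtain ⟨N, hN⟩ := exists_pow_le_cmQ0 x (3 * ℓ - 2)
  have hQ : IsLocalRing.maximalIdeal S ^ N ≤
      (∏ s ∈ Finset.range (3 * ℓ - 2), cmA[s]) * (PP ⊔ M ^ 2) := by rw [← hx]; exact hN
  rw [← hx] at hf
  exact atomConclusion_of_pointBlowup_charts x hx h𝔪 hI hQ (fun i Y' ρ h => by
    rw [cmI_mul_Q0 x ℓ hℓ] at h
    by_cases hi : i = 3
    · subst hi
      exact isRegular_of_isBlowup_cmIQ_three x hx hd _ h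
    · exact isRegular_of_isBlowup_cmIQ_of_ne_three x hx hd _ i hi h) T f hf

end LevelOneRegular

/-- **The `ringKrullDim` binder shape.** [cite: StacksProject, Tag 080A] [cite: Liu2002, Thm. 8.1.19 (a)] -/
theorem coreRung_coneCube_depth_of_ringKrullDim {S : Type u} [CommRing S]
    [IsRegularLocalRing S] (x : Fin 4 → S)
    (hx : Ideal.span (Set.range x) = IsLocalRing.maximalIdeal S)
    (hdim : ringKrullDim S = (4 : ℕ)) (ℓ : ℕ) (hℓ : 1 ≤ ℓ) (T : Scheme.{u}) (f : T ⟶ Spec (.of S))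
    (hf : IsBlowup f (affineBlowup.idealSheaf
      (Ideal.span {x 0 * x 1 + x 2 ^ 2 + x 3 ^ 3} ⊔ IsLocalRing.maximalIdeal S ^ (ℓ + 2)))) :
    ∃ (J : T.IdealSheafData) (T' : Scheme.{u}) (π : T' ⟶ T), J ≠ ⊥ ∧
      (∀ t : T, t ∈ J.support → f.base t = IsLocalRing.closedPoint S) ∧
      IsBlowup π J ∧ Scheme.IsRegular T' := by
  have hd : (IsLocalRing.maximalIdeal S).spanFinrank = 4 := by
    have h := IsRegularLocalRing.spanFinrank_maximalIdeal (R := S)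
    rw [hdim] at h
    exact_mod_cast h
  exact coreRung_coneCube_depth x hx hd ℓ hℓ T f hf

/-- **The registered core's binder shape, restricted to the members** (hypotheses of
`stub_atomDimFourBlowup`; characteristic, completeness, residue field and the off-fibre hypothesis
unused): the contact-migration member at every depth `ℓ ≥ 1`.
[cite: StacksProject, Tag 080A] [cite: Liu2002, Thm. 8.1.19 (a)] -/
theorem atomDimFourBlowupAt_coneCube_depth (p : ℕ) (_hp : p.Prime) (S : Type) [CommRing S]
    [IsRegularLocalRing S] [CharP S p] [IsAdicComplete (IsLocalRing.maximalIdeal S) S]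
    [PerfectField (IsLocalRing.ResidueField S)] (hS : ringKrullDim S = (4 : ℕ))
    (x : Fin 4 → S) (hx : Ideal.span (Set.range x) = IsLocalRing.maximalIdeal S)
    (ℓ : ℕ) (hℓ : 1 ≤ ℓ) (T : Scheme.{0}) (f : T ⟶ Spec (.of S))
    (hf : IsBlowup f (affineBlowup.idealSheaf
      (Ideal.span {x 0 * x 1 + x 2 ^ 2 + x 3 ^ 3} ⊔ IsLocalRing.maximalIdeal S ^ (ℓ + 2))))
    (_hoff : ∀ t : T, f.base t ≠ IsLocalRing.closedPoint S →
      IsRegularLocalRing (T.presheaf.stalk t)) :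
    ∃ (J : T.IdealSheafData) (T' : Scheme.{0}) (π : T' ⟶ T), J ≠ ⊥ ∧
      (∀ t : T, t ∈ J.support → f.base t = IsLocalRing.closedPoint S) ∧
      IsBlowup π J ∧ Scheme.IsRegular T' :=
  coreRung_coneCube_depth_of_ringKrullDim x hx hS ℓ hℓ T f hf

end ConeRung

end Summit.ResolutionOfSingularities.ResolutionOfSingularities.Theorems

end
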